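import Summits.ValiantsHypothesis.ValiantsHypothesis.Theorems.SymPencilEquivariantSdcNotQPPermEmbeddingOfYoungFixedVector
import Summits.ValiantsHypothesis.ValiantsHypothesis.Theorems.SymPencilEquivariantSdcNotQPYoungDegreeBound
import HarnessLib

/-!
# ValiantsHypothesis / SymPencil — crux `EquivariantSdcNotQP` (stmt-ValiantsHypothesis-17792), line
# `birth_EquivariantSdcNotQP`: the registered stub `stub_permify`, PROVED

The registered stub `stub_permify` of the line `Cruxes/SdcThesis/Lines/birth_EquivariantSdcNotQP.lean`
(linear lifts ⇒ permutation lifts at quasi-polynomial cost for `Γ_n`-equivariant symmetric affine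
pencils of `per_n`), with the statement VERBATIM (the skeleton's abbreviation `permPairSubst n` —
the row/column permutation pairs `Γ_n ≤ GL(n², ℂ)` — unfolded to its body).

Proof = the kernel-checked chain built on this line by val-lit-p7 g9/g10/g11, val-lit-p6 g12 and
val-width-17792-p1 (all files `Theorems/SymPencilEquivariantSdcNotQP*.lean`):
`stub_permify` ⇐ (iii′) `PermEmbeddingQP` [`permify_of_permEmbedding`: conjugation normal form at the
`Γ_n`-fixed point, finite conjugation lift group with scalar unimodular fibre, extension by the
identity along an equivariant retract] ⇐ (iii″) ⇐ (D) [`permEmbeddingQP_of_irreducible`: Maschke +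
Frobenius retracts] ⇐ (H1) ∧ (H2) [`permEmbeddingD_of_alternatingBounds`], with
**(H1) the spin dichotomy PROVED** at the `𝔖_n × 𝔖_n` level (`SpinDichotomy.spinDichotomy_symmetric`:
Schur's normalisation of projective Coxeter generators, the tree's universal property of `𝔖_n`
as a Coxeter group, the Clifford degree bound; `permEmbeddingD_of_youngFixedVector`) and
**(H2) Young fixed vectors PROVED** (`YoungBounds.youngFixedVector_holds`, val-lit-p6 g12: Young's
rule in the Young-symmetrizer model, `𝔄_n`-fixed vectors, the Young degree bound (YD)).

Honest framing: this closes the stub `stub_permify`; together with `stub_toSymmetricCircuit`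
(p568051) the line's composition `equivariantSdcNotQP_of` then yields the crux — that closing file
is separate.  `VP ≠ VNP` is NOT proved and nothing here is progress on it beyond this crux of
route SymPencil.
-/

noncomputable section

set_option linter.dupNamespace false

namespace Summit.ValiantsHypothesis.ValiantsHypothesis.Theorems.SymPencilEquivariantSdcNotQP

open MvPolynomial Matrix Literature.Computability.AlgebraicComplexity

/-- **`stub_permify`** (registered stub of crux 17792's line `birth_EquivariantSdcNotQP`, statement
verbatim with `permPairSubst n` unfolded).  Linear lifts ⇒ permutation lifts, conjugation form, at
quasi-polynomial cost: a `Γ_n`-equivariant symmetric affine pencil of size `m` for `per_n` yields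
an affine pencil `A'` of size `m' ≤ 2^{(log₂ m + d)^d}` with `det A' = per_n` such that every
substitution `x_{ij} ↦ x_{π i, ρ j}` is undone by conjugation with a permutation matrix.
Proof: `permify_of_youngFixedVector` ((H2) → conclusion, with the spin dichotomy (H1) proved inside)
applied to `YoungBounds.youngFixedVector_holds` ((H2), proved). [folklore] -/
theorem stub_permify :
    ∃ d : ℕ, ∀ (n m : ℕ) (A : Matrix (Fin m) (Fin m) (MvPolynomial (Fin n × Fin n) ℂ)),
      A.IsSymm → IsEquivariantDetRepr (Subgroup.closure {γ : GL (Fin n × Fin n) ℂ |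
        ∃ π ρ : Equiv.Perm (Fin n), (γ : Matrix (Fin n × Fin n) (Fin n × Fin n) ℂ) =
          Equiv.Perm.permMatrix ℂ (Equiv.prodCongr π ρ)}) (perPoly (Fin n) ℂ) A →
      ∃ m' ≤ 2 ^ ((Nat.log 2 m + d) ^ d),
        ∃ A' : Matrix (Fin m') (Fin m') (MvPolynomial (Fin n × Fin n) ℂ),
          IsAffineDetRepr (perPoly (Fin n) ℂ) A' ∧
          ∀ π ρ : Equiv.Perm (Fin n), ∃ σ : Equiv.Perm (Fin m'),
            A'.map (MvPolynomial.rename fun ij : Fin n × Fin n => (π ij.1, ρ ij.2)) =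
              (σ.permMatrix ℂ).map MvPolynomial.C * A' * ((σ.permMatrix ℂ)ᵀ).map MvPolynomial.C :=
  permify_of_youngFixedVector YoungBounds.youngFixedVector_holds

end Summit.ValiantsHypothesis.ValiantsHypothesis.Theorems.SymPencilEquivariantSdcNotQP

end
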